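import Literature.Analysis.FluidPDE.CKNPressureDualityFar
import Literature.Analysis.FluidPDE.CKNVelocityIntegrability
import Literature.Analysis.FunctionSpaces.LpDualityTestFunctions
import HarnessLib

/-!
# Local `L^q` integrability of the pressure under `(ℋ_CKN)`, given Stein's Proposition 3

Analysis/FluidPDE file (all results proved) in the decomposition of the named fact
`Literature.Analysis.FluidPDE.LemarieRieusset2016.pressure_localIntegrability`
(`CKNMorreyLemmas.lean`; Lemarié-Rieusset 2016, (13.19)–(13.21), p. 461, as used on p. 467):
under `(ℋ_CKN)` on a domain `Ω`, for `I × B(x_B, 2r_B) ⊆ Ω` the pressure is in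
`L^q_{t,x}(I × B)` for every `1 ≤ q ≤ min(q₀, 5/3)`. This file **proves** it conditionally on
the tree's single Calderón–Zygmund named fact, Stein 1970, Ch. III §1.3, Prop. 3
(`stein1970_hessian_Lp_bound ℝ³`, `HessianLaplacianLp`):

* `LemarieRieusset2016.pressure_localIntegrability_of_stein :
    stein1970_hessian_Lp_bound ℝ³ → pressure_localIntegrability`.

## Proof (the printed argument, with the Newtonian kernel moved onto the test function)

For `θ ∈ C_c^∞(S)`, `S = I × B`, let `Θ = N_{ρ/2,ρ}[θ(t,·)]` be the slicewise truncated
Newtonian potential (`ρ = r_B/2`, so that `Θ ∈ C_c^∞(I × B(x_B, 3r_B/2))`,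
`NewtonTestPotential`). The pressure equation (13.19) tested with `Θ` gives
`∫∫ p θ = ∫∫ p Λθ - ∫∫ D²Θ(u,u)` (`CKNPressureDuality`); the first term is bounded by
`L |B|^{1-1/q'} ‖∫_{Ω_t}|p|‖_{L^q(I)} ‖θ‖_{L^{q'}(S)}` using only `p ∈ L^{q₀}_t L¹_x`
(`CKNPressureDualityFar`, the part `p_B` of (13.20)), the second by
`9 C ‖u‖²_{L^{10/3}(I × B(x_B,3r_B/2))} ‖θ‖_{L^{5/2}(S)}` using Stein's bound and
`u ∈ L^{10/3}_{t,x}` ((13.18), `CKNVelocityIntegrability`) (the part `ϖ_B`), and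
`‖θ‖_{L^{5/2}(S)} ≤ |S|^{2/5-1/q'} ‖θ‖_{L^{q'}(S)}` as `q' ≥ 5/2`. Hence
`|∫∫_S p θ| ≤ K ‖θ‖_{L^{q'}(S)}` with `K < ∞`, and the converse of Hölder's inequality
(`Literature.Analysis.FunctionSpaces.lintegral_rpow_enorm_le_of_forall_test`) yields
`∫∫_S |p|^q ≤ K^q < ∞`. The case `q = 1` is the bound `∫∫_S |p| ≤ ∫_I ∫_{Ω_t} |p| < ∞`.

## References

* P. G. Lemarié-Rieusset, *The Navier–Stokes Problem in the 21st Century*, CRC Press (2016),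
  (13.19)–(13.21) p. 461 and §13.9 p. 467. [LemarieRieusset2016]
* E. M. Stein, *Singular integrals and differentiability properties of functions* (1970),
  Ch. III §1.3, Prop. 3. [Stein1971]
-/

noncomputable section

open MeasureTheory Set Function Filter Topology TopologicalSpace Metric InnerProductSpace
open scoped ENNReal NNReal RealInnerProductSpace ContDiff

namespace Literature.Analysis.FluidPDE

/-! ### Tools -/

/-- `L^r(Ω)` functions, `1 ≤ r`, are locally integrable on the open set `Ω ⊆ ℝ × ℝ³`. [folklore] -/
private theorem locallyIntegrableOn_of_memLp_restrict_vol {F : Type*} [NormedAddCommGroup F]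
    {g : ℝ × EuclideanSpace ℝ (Fin 3) → F} {Ω : Set (ℝ × EuclideanSpace ℝ (Fin 3))}
    (hΩ : IsOpen Ω) {r : ℝ≥0∞} (hr : 1 ≤ r) (hg : MemLp g r (volume.restrict Ω)) :
    LocallyIntegrableOn g Ω volume := by
  rw [locallyIntegrableOn_iff hΩ.isLocallyClosed]
  intro K hKΩ hK
  have h1 : MemLp g r (volume.restrict K) := hg.mono_measure (Measure.restrict_mono hKΩ le_rfl)
  haveI : IsFiniteMeasure ((volume : Measure (ℝ × EuclideanSpace ℝ (Fin 3))).restrict K) :=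
    ⟨by rw [Measure.restrict_apply_univ]; exact hK.measure_lt_top⟩
  exact memLp_one_iff_integrable.1 (h1.mono_exponent hr)

/-- From `q ≤ 5/3` and `1 < q`: the conjugate exponent `q' = q/(q-1)` satisfies `5/2 ≤ q'`.
[folklore] -/
theorem five_halves_le_conj {q q' : ℝ} (hqq' : q.HolderConjugate q') (hq : q ≤ 5 / 3) :
    5 / 2 ≤ q' := by
  have h1 := hqq'.inv_add_inv_eq_one
  have hq1 : 1 < q := hqq'.lt
  have hq'0 : 0 < q' := hqq'.symm.pos
  have hinv : q'⁻¹ ≤ 2 / 5 := by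
    have : 3 / 5 ≤ q⁻¹ := by
      rw [le_inv_comm₀ (by norm_num) (by linarith)]
      linarith
    linarith
  calc (5 / 2 : ℝ) = (2 / 5 : ℝ)⁻¹ := by norm_num
    _ ≤ q'⁻¹⁻¹ := by
        rw [inv_le_inv₀ (by norm_num) (inv_pos.2 hq'0)]; exact hinv
    _ = q' := inv_inv q'

namespace LemarieRieusset2016

/-! ### The conditional discharge -/

/-- **Local space–time integrability of the pressure under `(ℋ_CKN)`, conditionally on
Stein's Proposition 3** (Lemarié-Rieusset 2016, (13.19)–(13.21) p. 461, as used on p. 467;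
Stein 1970, III §1.3 Prop. 3 is the tree's named fact `stein1970_hessian_Lp_bound`). See the
file docstring for the proof. [cite: LemarieRieusset2016, (13.19)–(13.21) p. 461 and §13.9 p. 467] -/
theorem pressure_localIntegrability_of_stein
    (hStein : stein1970_hessian_Lp_bound (EuclideanSpace ℝ (Fin 3))) :
    pressure_localIntegrability := by
  intro ν q₀ Ω f u p G hν hq₀ hconn hE hG hGsq hpcl hf hdivf hns a b xB rB hab hrB hsub q hq1
    hqq₀ hq53
  -- geometry
  set I : Set ℝ := Ioo a b with hI
  set B : Set (EuclideanSpace ℝ (Fin 3)) := ball xB rB with hB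
  set S : Set (ℝ × EuclideanSpace ℝ (Fin 3)) := Ioo a b ×ˢ ball xB rB with hS
  set ρ : ℝ := rB / 2 with hρ
  have hρ0 : 0 < ρ := by positivity
  set S' : Set (ℝ × EuclideanSpace ℝ (Fin 3)) := Ioo a b ×ˢ ball xB (rB + ρ) with hS'
  have hS'Ω : S' ⊆ (Ω : Set (ℝ × EuclideanSpace ℝ (Fin 3))) :=
    (Set.prod_mono Subset.rfl (ball_subset_ball (by rw [hρ]; linarith))).trans hsub
  have hSS' : S ⊆ S' := Set.prod_mono Subset.rfl (ball_subset_ball (by linarith))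
  have hSΩ : S ⊆ (Ω : Set (ℝ × EuclideanSpace ℝ (Fin 3))) := hSS'.trans hS'Ω
  have hSopen : IsOpen S := isOpen_Ioo.prod isOpen_ball
  have hSfin : volume S ≠ ⊤ := by
    rw [hS, Measure.volume_eq_prod, Measure.prod_prod]
    exact ENNReal.mul_ne_top measure_Ioo_lt_top.ne measure_ball_lt_top.ne
  -- the pressure: measurability and the `L^{q₀}_t L¹_x` quantity
  have hu_loc := hns.1
  have hp_loc := hns.2.2.1
  have hpΩ : AEStronglyMeasurable (uncurry p)
      ((volume : Measure (ℝ × EuclideanSpace ℝ (Fin 3))).restrict Ω) :=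
    hp_loc.aestronglyMeasurable
  set P : ℝ × EuclideanSpace ℝ (Fin 3) → ℝ≥0∞ :=
    (Ω : Set (ℝ × EuclideanSpace ℝ (Fin 3))).indicator fun z => ‖p z.1 z.2‖ₑ with hP
  set π : ℝ → ℝ≥0∞ := fun t => ∫⁻ x, P (t, x) with hπ
  have hPm : AEMeasurable P (volume : Measure (ℝ × EuclideanSpace ℝ (Fin 3))) := by
    have h1 : AEStronglyMeasurable ((Ω : Set (ℝ × EuclideanSpace ℝ (Fin 3))).indicator
        (uncurry p)) (volume : Measure (ℝ × EuclideanSpace ℝ (Fin 3))) :=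
      (aestronglyMeasurable_indicator_iff Ω.isOpen.measurableSet).2 hpΩ
    have h2 : P = fun z =>
        ‖(Ω : Set (ℝ × EuclideanSpace ℝ (Fin 3))).indicator (uncurry p) z‖ₑ := by
      funext z
      rw [hP, enorm_indicator_eq_indicator_enorm]
      rfl
    rw [h2]
    exact h1.enorm
  have hπm : AEMeasurable π (volume : Measure ℝ) := by
    have h := hPm
    rw [Measure.volume_eq_prod] at h
    exact h.lintegral_prod_right'
  have hq0 : 0 < q := one_pos.trans_le hq1
  -- `∫_I π^q < ∞` for `q ≤ q₀`, and `∫_I π < ∞`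
  have hPiq : ∫⁻ t in I, π t ^ q < ⊤ :=
    setLIntegral_rpow_lt_top_of_le volume (s := I) measure_Ioo_lt_top.ne hπm.restrict hq0 hqq₀
      ((setLIntegral_le_lintegral I _).trans_lt hpcl)
  have hPi1 : ∫⁻ t in I, π t < ⊤ := by
    have h := setLIntegral_rpow_lt_top_of_le volume (s := I) measure_Ioo_lt_top.ne hπm.restrict
      one_pos hq₀.le ((setLIntegral_le_lintegral I _).trans_lt hpcl)
    simpa only [ENNReal.rpow_one] using h
  -- `p ∈ L¹(S)`
  have hpS1 : ∫⁻ z in S, ‖p z.1 z.2‖ₑ ≤ ∫⁻ t in I, π t := by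
    calc ∫⁻ z in S, ‖p z.1 z.2‖ₑ = ∫⁻ z, S.indicator (fun z => ‖p z.1 z.2‖ₑ) z :=
          (lintegral_indicator hSopen.measurableSet _).symm
      _ ≤ ∫⁻ z, I.indicator (fun _ => (1 : ℝ≥0∞)) z.1 * P z := by
          refine lintegral_mono fun z => ?_
          by_cases hz : z ∈ S
          · rw [indicator_of_mem hz, indicator_of_mem hz.1, hP, indicator_of_mem (hSΩ hz), one_mul]
          · rw [indicator_of_notMem hz]; exact zero_le
      _ ≤ ∫⁻ t, ∫⁻ x, I.indicator (fun _ => (1 : ℝ≥0∞)) t * P (t, x) := by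
          rw [Measure.volume_eq_prod]; exact lintegral_prod_le _
      _ = ∫⁻ t, I.indicator (fun _ => (1 : ℝ≥0∞)) t * π t := by
          refine lintegral_congr fun t => ?_
          rw [lintegral_const_mul' _ _ (by by_cases ht : t ∈ I <;> simp [ht])]
      _ = ∫⁻ t in I, π t := by
          rw [← lintegral_indicator measurableSet_Ioo]
          refine lintegral_congr fun t => ?_
          by_cases ht : t ∈ I
          · rw [indicator_of_mem ht, indicator_of_mem ht, one_mul]
          · rw [indicator_of_notMem ht, indicator_of_notMem ht, zero_mul]
  have hpS_meas : AEStronglyMeasurable (uncurry p)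
      ((volume : Measure (ℝ × EuclideanSpace ℝ (Fin 3))).restrict S) :=
    hpΩ.mono_measure (Measure.restrict_mono hSΩ le_rfl)
  have hpInt : IntegrableOn (uncurry p) S volume := ⟨hpS_meas, hpS1.trans_lt hPi1⟩
  -- the case `q = 1`
  rcases hq1.eq_or_lt with rfl | hq1'
  · simpa only [ENNReal.rpow_one] using hpS1.trans_lt hPi1
  -- the conjugate exponent
  have hqq' : q.HolderConjugate (Real.conjExponent q) := Real.HolderConjugate.conjExponent hq1'
  set q' : ℝ := Real.conjExponent q with hq'def
  have hq'0 : 0 < q' := hqq'.symm.pos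
  have hq'1 : 1 < q' := hqq'.symm.lt
  have hq'52 : 5 / 2 ≤ q' := five_halves_le_conj hqq' hq53
  -- constants: Stein, the bound for `λ`, the `L^{10/3}` norm of `u`
  obtain ⟨C, hC⟩ := hStein.hessian_newtonNearPotential_half (p := ENNReal.ofReal (5 / 2))
    (ENNReal.one_lt_ofReal.2 (by norm_num)) ENNReal.ofReal_lt_top
  have h₀ : 0 < ρ / 2 := by positivity
  have h₁ : ρ / 2 < ρ := by linarith
  obtain ⟨L₀, hL₀⟩ := (continuous_newtonFarLaplacian h₀ h₁).bounded_above_of_compact_support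
    (hasCompactSupport_newtonFarLaplacian h₀.le h₁)
  set L : ℝ≥0 := L₀.toNNReal with hLdef
  have hL : ∀ z, ‖newtonFarLaplacian (ρ / 2) ρ z‖ ≤ L := fun z =>
    (hL₀ z).trans (Real.le_coe_toNNReal L₀)
  have hum : AEStronglyMeasurable (uncurry u)
      ((volume : Measure (ℝ × EuclideanSpace ℝ (Fin 3))).restrict S') :=
    (hu_loc.mono_set hS'Ω).aestronglyMeasurable
  set U : ℝ≥0∞ := ∫⁻ z in S', ‖u z.1 z.2‖ₑ ^ (10 / 3 : ℝ) with hU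
  have hUfin : U < ⊤ :=
    lintegral_rpow_ten_thirds_lt_top_of_energy finrank_euclideanSpace_three hE hG hGsq hS'Ω
  have hfi : LocallyIntegrableOn (uncurry f) (Ω : Set (ℝ × EuclideanSpace ℝ (Fin 3))) volume :=
    locallyIntegrableOn_of_memLp_restrict_vol Ω.isOpen (ENNReal.one_le_ofReal.2 (by norm_num)) hf
  -- the constant of the dual bound
  set K : ℝ≥0∞ := (L : ℝ≥0∞) * volume B ^ (1 - 1 / q') * (∫⁻ t in I, π t ^ q) ^ (1 / q) +
    9 * C * U ^ (3 / 5 : ℝ) * volume S ^ (2 / 5 - 1 / q') with hK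
  have hKfin : K ≠ ⊤ := by
    refine ENNReal.add_ne_top.2 ⟨?_, ?_⟩
    · refine ENNReal.mul_ne_top (ENNReal.mul_ne_top ENNReal.coe_ne_top
        (ENNReal.rpow_ne_top_of_nonneg ?_ measure_ball_lt_top.ne))
        (ENNReal.rpow_ne_top_of_nonneg (by positivity) hPiq.ne)
      rw [sub_nonneg, div_le_one hq'0]; exact hq'1.le
    · refine ENNReal.mul_ne_top (ENNReal.mul_ne_top (ENNReal.mul_ne_top (by simp)
        ENNReal.coe_ne_top) (ENNReal.rpow_ne_top_of_nonneg (by norm_num) hUfin.ne))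
        (ENNReal.rpow_ne_top_of_nonneg ?_ hSfin)
      rw [sub_nonneg, div_le_iff₀ hq'0]; linarith
  -- the dual bound for one test function
  have hdual : ∀ Ψ : ℝ × EuclideanSpace ℝ (Fin 3) → ℝ, ContDiff ℝ (⊤ : ℕ∞) Ψ →
      HasCompactSupport Ψ → tsupport Ψ ⊆ S →
      ‖∫ z in S, uncurry p z * Ψ z‖ₑ ≤ K * (∫⁻ z in S, ‖Ψ z‖ₑ ^ q') ^ (1 / q') := by
    intro Ψ hΨ1 hΨ2 hΨ3
    set θ : ℝ → EuclideanSpace ℝ (Fin 3) → ℝ := fun t x => Ψ (t, x) with hθdef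
    have hθ : IsSpaceTimeTestOn (⟨Ioo a b ×ˢ ball xB rB, isOpen_Ioo.prod isOpen_ball⟩ :
        Opens (ℝ × EuclideanSpace ℝ (Fin 3))) θ := ⟨hΨ1, hΨ2, hΨ3⟩
    have hΨ0 : ∀ z, z ∉ S → Ψ z = 0 := fun z hz =>
      image_eq_zero_of_notMem_tsupport fun h => hz (hΨ3 h)
    -- `∫_S p Ψ = ∫_Ω p θ`
    have e1 : ∫ z in S, uncurry p z * Ψ z =
        ∫ z in (Ω : Set (ℝ × EuclideanSpace ℝ (Fin 3))), p z.1 z.2 * θ z.1 z.2 := by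
      rw [setIntegral_eq_integral_of_forall_compl_eq_zero fun z hz => ?_,
        setIntegral_eq_integral_of_forall_compl_eq_zero fun z hz => ?_]
      · rfl
      · change p z.1 z.2 * Ψ (z.1, z.2) = 0
        rw [hΨ0 z fun h => hz (hSΩ h), mul_zero]
      · change p z.1 z.2 * Ψ z = 0
        rw [hΨ0 z hz, mul_zero]
    -- the identity and the two bounds
    have e2 := hns.integral_pressure_mul_test_eq hfi hdivf hρ0 hS'Ω hθ
    have b1 := enorm_setIntegral_mul_newtonFarSmoothing_le (Ω := Ω) (ρ := ρ) hpΩ hL hθ hqq'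
    have b2 := enorm_integral_hessian_newtonNearPotential_le (u := u) hC hρ0 hθ hum
      (Ω : Set (ℝ × EuclideanSpace ℝ (Fin 3)))
    set Tq : ℝ≥0∞ := ∫⁻ z in S, ‖θ z.1 z.2‖ₑ ^ q' with hTq
    set T52 : ℝ≥0∞ := ∫⁻ z in S, ‖θ z.1 z.2‖ₑ ^ (5 / 2 : ℝ) with hT52
    have b3 : T52 ^ (2 / 5 : ℝ) ≤ Tq ^ (1 / q') * volume S ^ (2 / 5 - 1 / q') := by
      have hF : AEMeasurable (fun z : ℝ × EuclideanSpace ℝ (Fin 3) => ‖θ z.1 z.2‖ₑ)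
          ((volume : Measure (ℝ × EuclideanSpace ℝ (Fin 3))).restrict S) :=
        hΨ1.continuous.measurable.enorm.aemeasurable
      have h := setLIntegral_rpow_le_rpow_mul_measure_of_le volume S hF (a := 5 / 2) (c := q')
        (by norm_num) hq'52
      have h' := ENNReal.rpow_le_rpow h (by norm_num : (0 : ℝ) ≤ 2 / 5)
      rw [ENNReal.mul_rpow_of_nonneg _ _ (by norm_num), ← ENNReal.rpow_mul, ← ENNReal.rpow_mul]
        at h'
      have ex1 : (5 / 2 : ℝ) / q' * (2 / 5) = 1 / q' := by field_simp
      have ex2 : (1 - (5 / 2 : ℝ) / q') * (2 / 5) = 2 / 5 - 1 / q' := by field_simp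
      rw [ex1, ex2] at h'
      exact h'
    calc ‖∫ z in S, uncurry p z * Ψ z‖ₑ
        = ‖(∫ z in (Ω : Set (ℝ × EuclideanSpace ℝ (Fin 3))),
              p z.1 z.2 * newtonFarSmoothing (ρ / 2) ρ (θ z.1) z.2) -
            ∫ z in (Ω : Set (ℝ × EuclideanSpace ℝ (Fin 3))),
              fderiv ℝ (fderiv ℝ (newtonNearPotential (ρ / 2) ρ (θ z.1))) z.2 (u z.1 z.2)
                (u z.1 z.2)‖ₑ := by rw [e1, e2]
      _ ≤ ‖∫ z in (Ω : Set (ℝ × EuclideanSpace ℝ (Fin 3))),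
              p z.1 z.2 * newtonFarSmoothing (ρ / 2) ρ (θ z.1) z.2‖ₑ +
            ‖∫ z in (Ω : Set (ℝ × EuclideanSpace ℝ (Fin 3))),
              fderiv ℝ (fderiv ℝ (newtonNearPotential (ρ / 2) ρ (θ z.1))) z.2 (u z.1 z.2)
                (u z.1 z.2)‖ₑ := enorm_sub_le
      _ ≤ (L : ℝ≥0∞) * volume B ^ (1 - 1 / q') * (∫⁻ t in I, π t ^ q) ^ (1 / q) * Tq ^ (1 / q') +
            9 * C * U ^ (3 / 5 : ℝ) * T52 ^ (2 / 5 : ℝ) := add_le_add b1 b2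
      _ ≤ (L : ℝ≥0∞) * volume B ^ (1 - 1 / q') * (∫⁻ t in I, π t ^ q) ^ (1 / q) * Tq ^ (1 / q') +
            9 * C * U ^ (3 / 5 : ℝ) * (Tq ^ (1 / q') * volume S ^ (2 / 5 - 1 / q')) := by
          gcongr
      _ = K * Tq ^ (1 / q') := by rw [hK]; ring
  -- to the real-valued form, and the converse of Hölder's inequality
  have hbound : ∀ Ψ : ℝ × EuclideanSpace ℝ (Fin 3) → ℝ, ContDiff ℝ (⊤ : ℕ∞) Ψ →
      HasCompactSupport Ψ → tsupport Ψ ⊆ S →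
      |∫ z in S, uncurry p z * Ψ z| ≤ K.toReal * (eLpNorm Ψ (ENNReal.ofReal q') volume).toReal := by
    intro Ψ h1 h2 h3
    have h := hdual Ψ h1 h2 h3
    have hsupp : support (fun z : ℝ × EuclideanSpace ℝ (Fin 3) => ‖Ψ z‖ₑ ^ q') ⊆ S := by
      intro z hz
      by_contra hzS
      exact hz (by simp [image_eq_zero_of_notMem_tsupport (f := Ψ) (fun h' => hzS (h3 h')),
        ENNReal.zero_rpow_of_pos hq'0])
    have hE : eLpNorm Ψ (ENNReal.ofReal q') volume = (∫⁻ z in S, ‖Ψ z‖ₑ ^ q') ^ (1 / q') := by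
      rw [eLpNorm_eq_lintegral_rpow_enorm_toReal (by simp [hq'0]) ENNReal.ofReal_ne_top,
        ENNReal.toReal_ofReal hq'0.le, setLIntegral_eq_of_support_subset hsupp]
    have hEfin : eLpNorm Ψ (ENNReal.ofReal q') volume < ⊤ :=
      (h1.continuous.memLp_of_hasCompactSupport h2).eLpNorm_lt_top
    rw [← hE] at h
    rw [← ENNReal.toReal_mul, ← ENNReal.ofReal_le_iff_le_toReal (ENNReal.mul_ne_top hKfin
      hEfin.ne), ← Real.enorm_eq_ofReal_abs]
    exact h
  haveI : (volume : Measure (ℝ × EuclideanSpace ℝ (Fin 3))).IsAddHaarMeasure := by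
    rw [Measure.volume_eq_prod]; infer_instance
  have hmain := FunctionSpaces.lintegral_rpow_enorm_le_of_forall_test hSopen hpInt hqq'
    ENNReal.toReal_nonneg hbound
  exact hmain.trans_lt ENNReal.ofReal_lt_top

end LemarieRieusset2016

end Literature.Analysis.FluidPDE
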